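import Summits.CriticalPhenomena.PercolationContinuityZ3.Theorems.SahiIsingThreeSites
import Summits.CriticalPhenomena.PercolationContinuityZ3.Theorems.SahiFourCoordinates

/-!
# Unconditionally, order 3: functions of FOUR spins under box-TP₂ spin laws and the infinite-volume Ising states

Support file of the Sahi cell (`prim-sahi`, typer seat, generation 36; `--supports stmt-CriticalPhenomena-4575`).
Theorems only (no definitions, no named facts, no sorries); standard axioms.  Companion of `SahiIsingThreeSites.lean` (typer gen 13:
THREE sites, EVERY order) — here FOUR sites at ORDER `3`, through P4's standard-axiom theorem that every FKG probability weight on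
`{0,1}⁴` is Sahi-positive of order `3` (`SahiC3CubeFourFKG.sahiPositive_three_cube_four`), read on the spin cube `{−1,+1}⁴`
(`SahiFourCoordinates.sahiPositive_three_spinCube_four`) and transported to infinite volume by gen 13's window transfer
`msahiE_comp_latticeHom_nonneg_of_isBoxTP2` (window marginals of box-TP₂ laws are FKG weights).

* `msahiE_three_fourSites_nonneg_of_isBoxTP2` — **for a box-TP₂ probability measure on `{−1,+1}^ι`, any four sites `v₀,…,v₃`
  (repetitions allowed) and all nonnegative functions `g₀, g₁, g₂` of `(σ_{v₀},…,σ_{v₃})` nondecreasing in each spin: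
  `E₃(g₀(σ_v), g₁(σ_v), g₂(σ_v)) ≥ 0` — Sahi's `C₃` [Sahi2008, Conj. 5; LiebSahi2022, Conj. 1.1 at `n = 3`] for these observables.**
* The Ising states on `ℤ^d`: `plusState_msahiE_three_fourSites_nonneg`, `minusState_…` (`β ≥ 0`, any `h`), `freeState_…` (`h ≥ 0`),
  `msahiE_three_fourSites_nonneg_of_isTailTrivial` (every extremal Gibbs state).
SCOPE: four fixed sites, order `3` (orders `n ≥ 4` for four spins of a non-product FKG law are open). [this work]
-/

noncomputable section

namespace Summit.CriticalPhenomena.PercolationContinuityZ3.Theorems.SahiBoxTP2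

open MeasureTheory ProbabilityTheory Set Filter Topology Function Literature.Combinatorics.Sahi2008
open Literature.Probability.LatticeModels
open scoped ENNReal

/-! ### Box-TP₂ spin laws -/

section Transfer

variable {ι : Type*} [Countable ι] [DecidableEq ι]

/-- **FOUR SITES, ORDER 3, UNCONDITIONALLY**: for a box-TP₂ probability measure `μ` on `{−1,+1}^ι`, sites `v₀,…,v₃ : ι` (repetitions
allowed) and nonnegative `g₀, g₁, g₂ : {−1,+1}⁴ → ℝ` nondecreasing in each spin: `0 ≤ E₃(g₀(σ_v), g₁(σ_v), g₂(σ_v))`.  (Every FKG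
weight on `{−1,+1}⁴` is Sahi-positive of order `3`: `SahiFourCoordinates.sahiPositive_three_spinCube_four`.) [this work] -/
theorem msahiE_three_fourSites_nonneg_of_isBoxTP2 (μ : Measure (ι → ℤˣ)) [IsProbabilityMeasure μ] (hμ : IsBoxTP2 μ)
    (v : Fin 4 → ι) (g : Fin 3 → (Fin 4 → ℤˣ) → ℝ) (hg0 : ∀ i y, 0 ≤ g i y) (hmono : ∀ i, Monotone (g i)) :
    0 ≤ msahiE μ 3 fun i σ => g i fun a => σ (v a) := by
  set J : Finset ι := Finset.univ.image v with hJ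
  have hv : ∀ a, v a ∈ J := fun a => Finset.mem_image_of_mem v (Finset.mem_univ a)
  set H : LatticeHom (↥J → ℤˣ) (Fin 4 → ℤˣ) :=
    { toFun := fun x a => x ⟨v a, hv a⟩
      map_sup' := fun x y => by funext a; simp only [Pi.sup_apply]
      map_inf' := fun x y => by funext a; simp only [Pi.inf_apply] } with hH
  exact msahiE_comp_latticeHom_nonneg_of_isBoxTP2 μ hμ J H
    (fun _ hν => SahiFourCoordinates.sahiPositive_three_spinCube_four hν) g hg0 hmono

end Transfer

/-! ### The infinite-volume Ising states on `ℤ^d` -/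

section Ising

variable {d : ℕ} {β h : ℝ}

/-- **PLUS STATE, four sites, order 3, unconditionally** (`β ≥ 0`, any `h`): for any four sites of `ℤ^d` and nonnegative `g₀, g₁, g₂`
of the four spins, nondecreasing in each spin, `0 ≤ E₃(g₀(σ_v), g₁(σ_v), g₂(σ_v))` under every probability measure with the plus
correlations. [this work] -/
theorem plusState_msahiE_three_fourSites_nonneg (hβ : 0 ≤ β) (μ : Measure (SpinConfig (Site d)))
    [IsProbabilityMeasure μ] (hμ : ∀ B : Finset (Site d), spinCorr μ B = plusCorr d β h B) (v : Fin 4 → Site d)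
    (g : Fin 3 → (Fin 4 → ℤˣ) → ℝ) (hg0 : ∀ i y, 0 ≤ g i y) (hmono : ∀ i, Monotone (g i)) :
    0 ≤ msahiE μ 3 fun i σ => g i fun a => σ (v a) :=
  msahiE_three_fourSites_nonneg_of_isBoxTP2 μ (isBoxTP2_of_forall_spinCorr_eq_plusCorr hβ μ hμ) v g hg0 hmono

/-- MINUS STATE, four sites, order 3 (`β ≥ 0`, any `h`). [this work] -/
theorem minusState_msahiE_three_fourSites_nonneg (hβ : 0 ≤ β) (μ : Measure (SpinConfig (Site d)))
    [IsProbabilityMeasure μ] (hμ : ∀ B : Finset (Site d), spinCorr μ B = minusCorr d β h B) (v : Fin 4 → Site d)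
    (g : Fin 3 → (Fin 4 → ℤˣ) → ℝ) (hg0 : ∀ i y, 0 ≤ g i y) (hmono : ∀ i, Monotone (g i)) :
    0 ≤ msahiE μ 3 fun i σ => g i fun a => σ (v a) :=
  msahiE_three_fourSites_nonneg_of_isBoxTP2 μ (isBoxTP2_of_forall_spinCorr_eq_minusCorr hβ μ hμ) v g hg0 hmono

/-- FREE STATE (`h ≥ 0`), four sites, order 3. [this work] -/
theorem freeState_msahiE_three_fourSites_nonneg (hβ : 0 ≤ β) (hh : 0 ≤ h) (μ : Measure (SpinConfig (Site d)))
    [IsProbabilityMeasure μ] (hμ : ∀ B : Finset (Site d), spinCorr μ B = freeCorr d β h B) (v : Fin 4 → Site d)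
    (g : Fin 3 → (Fin 4 → ℤˣ) → ℝ) (hg0 : ∀ i y, 0 ≤ g i y) (hmono : ∀ i, Monotone (g i)) :
    0 ≤ msahiE μ 3 fun i σ => g i fun a => σ (v a) :=
  msahiE_three_fourSites_nonneg_of_isBoxTP2 μ (isBoxTP2_of_forall_spinCorr_eq_freeCorr hβ hh μ hμ) v g hg0 hmono

/-- EVERY TAIL-TRIVIAL (extremal) Ising Gibbs state, four sites, order 3 (`β ≥ 0`, any `h`). [this work] -/
theorem msahiE_three_fourSites_nonneg_of_isTailTrivial (hβ : 0 ≤ β) {μ : Measure (SpinConfig (Site d))}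
    (hμ : μ ∈ isingGibbsMeasures d β h) (hμt : IsTailTrivial μ) (v : Fin 4 → Site d)
    (g : Fin 3 → (Fin 4 → ℤˣ) → ℝ) (hg0 : ∀ i y, 0 ≤ g i y) (hmono : ∀ i, Monotone (g i)) :
    0 ≤ msahiE μ 3 fun i σ => g i fun a => σ (v a) := by
  have hμG : IsGibbsMeasure (isingSpecification (zdGraph d) β h) μ := hμ
  haveI := hμG.isProbabilityMeasure
  exact msahiE_three_fourSites_nonneg_of_isBoxTP2 μ (isBoxTP2_of_isTailTrivial hβ hμ hμt) v g hg0 hmono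

end Ising

end Summit.CriticalPhenomena.PercolationContinuityZ3.Theorems.SahiBoxTP2
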